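import Mathlib.LinearAlgebra.Matrix.SchurComplement
import Mathlib.Algebra.Ring.GeomSum
import Literature.Computability.AlgebraicComplexity.RegularDetReprABP
import Literature.Computability.AlgebraicComplexity.DetReprEquivalent
import Literature.Computability.AlgebraicComplexity.PencilFamily
import HarnessLib

/-!
# Regular determinantal representations are single-matrix homogeneous ABPs — proof
# (Chatterjee–Kumar–Volk 2024, Thm. 13): discharge of `ChatterjeeKumarVolk2024_thm13`

Topic `Literature/Computability/AlgebraicComplexity`. This file DISCHARGES the named fact
`ChatterjeeKumarVolk2024_thm13` of `RegularDetReprABP.lean` (P. Chatterjee, M. Kumar, B. L. Volk,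
*Determinants vs. algebraic branching programs*, comput. complexity 33 (2024) = arXiv:2308.04599,
§3 Thm. 13 with the remark following its proof): over a field `F`, if a form `f` of degree `d ≥ 2`
has a REGULAR affine determinantal representation `A` of size `s` (affine entries, `det A = f`,
`rank A(0) = s - 1`), then `f = -bᵀ D^{d-2} c` for vectors `b, c` and an `(s-1) × (s-1)` matrix
`D` of homogeneous LINEAR forms, and `bᵀ Dⁱ c = 0` for `0 ≤ i ≤ d - 3` (a homogeneous ABP of
width `s - 1` all of whose middle layers are `D`). Cell `pub-gct-max` (track T, seat lit-1): the
`dc → homogeneous ABP` transfer on the «what suffices for `VP ≠ VNP`» axis; wanted as a theorem by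
the crux line `Summits/ValiantsHypothesis/…/DetqpThesis/Lines/one_cut_strength.lean`.

## The printed proof (arXiv:2308.04599 p. 7), followed step by step

1. "by applying elementary row and column operations we may assume that `M₀ = diag(0,1,…,1)`":
   the tree's Landsberg–Ressayre normal form `IsRegularDetRepr.exists_normalForm` gives invertible
   constant `V, U` and an index `i₀` with `(V A U)(0) = Λ_{i₀}`; `det (V A U) = κ f`, `κ ≠ 0`
   (`det_map_C_mul_mul_map_C`).
2. "we can write `M` in blocks as `M = [[a, bᵀ], [c, I - D]]` where `a`, `b`, `c`, `D` are
   homogeneous linear": `M = Λ + N` with `N = hc₁(M)` entrywise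
   (`eq_homogeneousComponent_zero_add_one` of `PencilFamily.lean`), and the four blocks of `N`
   (`D := -N₂₂`); the reindexing `Fin (m+1) ≃ Unit ⊕ Fin m` sends `i₀` to the `Unit` summand.
3. "`f = Det(I-D) · (a - bᵀ (I-D)⁻¹ c)` … expand `(I-D)⁻¹ = I + D + D² + ⋯` over `F[[x]]`":
   DEVIATION (same content, no power series): we pass to the quotient `F[x]/𝔪_{>d}` by the ideal
   (local to the proof) of polynomials with no homogeneous component of degree `≤ d`. There
   `D^{d+1} ≡ 0` (its entries are forms of degree `d + 1`), so `I - D` is invertible with inverse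
   `S = Σ_{i ≤ d} Dⁱ` (`mul_neg_geom_sum`), and Mathlib's Schur-complement formula
   `Matrix.det_fromBlocks₂₂` gives `κ f ≡ det(I - D) · (a - Σ_{i ≤ d} bᵀ Dⁱ c)  (mod 𝔪_{>d})`.
4. "the homogeneous component of degree `0` … is zero, the degree one component is `a`, … the
   degree `i` component equals `bᵀ D^{i-2} c`. Plugging this into (eq) …": with
   `det(I - D) = 1 + R`, `R(0) = 0`, comparing the
   components of degree `k ≤ d` (`key`) gives `a = 0` (`k = 1`), then by induction
   `bᵀ Dⁱ c = 0` for `i + 2 < d` and `-bᵀ D^{d-2} c = κ f` (`k = d`); `κ⁻¹` is absorbed into `b`.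

Degenerate size `s = 0` is excluded by the hypotheses (`det` of the empty matrix is `1`, not a
form of degree `≥ 2`). Gauge note (cell typing checklist 4c (i), lead D1057): the statement is about
one REGULAR representation read AFTER the `GL × GL` gauge has been fixed by the LR17 §3.3 normal
form; the witnesses `b, c, D` depend on that choice of `V, U, i₀` and are not canonical — exactly as
in print ("we may assume that `M₀ = diag(0,1,…,1)`"). Nothing here is new mathematics; honest framing (cell `pub-gct-max`): a
discharge of a cited, printed theorem; nothing here is a claim on `VP ≠ VNP` or `P ≠ NP`.

## Main statements

* `CKV2024.exists_eq_neg_dotProduct_pow_of_isRegularDetRepr` — Thm. 13 + remark for one regular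
  representation (the vended form of `RegularDetReprABP.lean`);
* `ChatterjeeKumarVolk2024_thm13_holds : ChatterjeeKumarVolk2024_thm13` — the discharge.

## References

* [ChatterjeeKumarVolk2024] P. Chatterjee, M. Kumar, B. L. Volk, *Determinants vs. algebraic
  branching programs*, comput. complexity 33 (2024), doi:10.1007/s00037-024-00258-z =
  arXiv:2308.04599: §3, Thm. 13 and the remark after its proof (e-print p. 7).
* [LandsbergRessayre2017] J. M. Landsberg, N. Ressayre, *Permanent v. determinant: an exponential
  lower bound assuming symmetry and a potential path towards Valiant's conjecture*, Differential
  Geom. Appl. 55 (2017): §3.3 (the normal form `Λ_{n-1}`), used through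
  `LandsbergRessayreNormalForm.lean`.
-/

noncomputable section

open Matrix MvPolynomial

namespace Literature.Computability.AlgebraicComplexity

universe u v

namespace CKV2024

variable {F : Type u} [Field F] {σ : Type v}

/-! ### Graded bookkeeping (private helpers) -/

/-- `hc_k (R · φ)` for a form `φ` of degree `n`: it is `φ · hc_{k-n} R` if `n ≤ k` and `0` otherwise.
[folklore] -/
private theorem homogeneousComponent_mul_of_isHomogeneous_right {φ : MvPolynomial σ F} {n : ℕ}
    (hφ : φ.IsHomogeneous n) (R : MvPolynomial σ F) (k : ℕ) :
    homogeneousComponent k (R * φ) = if n ≤ k then φ * homogeneousComponent (k - n) R else 0 := by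
  classical
  split_ifs with h
  · obtain ⟨j, rfl⟩ := Nat.exists_eq_add_of_le h
    rw [mul_comm, homogeneousComponent_mul_of_isHomogeneous hφ R j, Nat.add_sub_cancel_left]
  · rw [mul_comm, ← sum_homogeneousComponent R, Finset.mul_sum, map_sum]
    refine Finset.sum_eq_zero fun j _ => ?_
    rw [homogeneousComponent_of_mem (hφ.mul (homogeneousComponent_isHomogeneous j R)), if_neg]
    omega

/-! ### Forms in matrices: powers of a matrix of linear forms -/

/-- The entries of `D ^ n` are forms of degree `n` when the entries of `D` are linear forms.
[folklore] -/
private theorem isHomogeneous_pow_apply {ι : Type*} [Fintype ι] [DecidableEq ι]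
    {D : Matrix ι ι (MvPolynomial σ F)} (hD : ∀ i j, (D i j).IsHomogeneous 1) (n : ℕ) (i j : ι) :
    ((D ^ n) i j).IsHomogeneous n := by
  induction n generalizing i j with
  | zero =>
    rw [pow_zero, Matrix.one_apply]
    split_ifs
    · exact isHomogeneous_one σ F
    · exact isHomogeneous_zero σ F 0
  | succ n ih =>
    rw [pow_succ, Matrix.mul_apply]
    exact IsHomogeneous.sum _ _ _ fun l _ => (ih i l).mul (hD l j)

/-- `bᵀ Dⁿ c` is a form of degree `n + 2` for linear `b, c, D`. [folklore] -/
private theorem isHomogeneous_dotProduct_pow_mulVec {ι : Type*} [Fintype ι] [DecidableEq ι]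
    {b c : ι → MvPolynomial σ F} {D : Matrix ι ι (MvPolynomial σ F)}
    (hb : ∀ j, (b j).IsHomogeneous 1) (hD : ∀ i j, (D i j).IsHomogeneous 1)
    (hc : ∀ j, (c j).IsHomogeneous 1) (n : ℕ) :
    (b ⬝ᵥ (D ^ n) *ᵥ c).IsHomogeneous (n + 2) := by
  simp only [dotProduct, Matrix.mulVec]
  refine IsHomogeneous.sum _ _ _ fun j _ => ?_
  have h2 : (∑ l, (D ^ n) j l * c l).IsHomogeneous (n + 1) :=
    IsHomogeneous.sum _ _ _ fun l _ => (isHomogeneous_pow_apply hD n j l).mul (hc l)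
  have h3 := (hb j).mul h2
  rwa [show 1 + (n + 1) = n + 2 by ring] at h3

/-- `(B · X · C)_{⋆⋆} = bᵀ X c` for a one-row `B = (bᵀ)` and a one-column `C = (c)`. [folklore] -/
private theorem row_mul_mul_col_apply {ι : Type*} [Fintype ι] (b c : ι → MvPolynomial σ F)
    (X : Matrix ι ι (MvPolynomial σ F)) :
    (Matrix.of (fun (_ : Unit) j => b j) * X * Matrix.of (fun j (_ : Unit) => c j)) () () =
      b ⬝ᵥ X *ᵥ c := by
  rw [Matrix.mul_assoc]
  simp only [Matrix.mul_apply, Matrix.of_apply, dotProduct, Matrix.mulVec]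

/-- Linear forms have no constant term. [folklore] -/
private theorem constantCoeff_eq_zero_of_isHomogeneous_one {p : MvPolynomial σ F} (hp : p.IsHomogeneous 1) :
    constantCoeff p = 0 := by
  rw [constantCoeff_eq]
  exact hp.coeff_eq_zero (by simp)

/-- `det (1 - D)` has constant term `1` when `D` is a matrix of linear forms. [folklore] -/
private theorem homogeneousComponent_zero_det_one_sub {ι : Type*} [Fintype ι] [DecidableEq ι]
    {D : Matrix ι ι (MvPolynomial σ F)} (hD : ∀ i j, (D i j).IsHomogeneous 1) :
    homogeneousComponent 0 ((1 - D).det - 1) = 0 := by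
  have h : constPart (1 - D) = 1 := by
    ext i j
    rw [constPart_apply, Matrix.sub_apply, map_sub, constantCoeff_eq_zero_of_isHomogeneous_one (hD i j),
      sub_zero, Matrix.one_apply, Matrix.one_apply]
    split_ifs <;> simp
  have hc : constantCoeff ((1 - D).det - 1) = 0 := by
    rw [map_sub, ← det_constPart, h, Matrix.det_one, map_one, sub_self]
  have hc' : coeff 0 ((1 - D).det - 1) = 0 := hc
  rw [homogeneousComponent_zero, hc', C_0]

/-! ### The theorem -/

/-- **Chatterjee–Kumar–Volk 2024, Thm. 13 (with the remark after its proof)**, for one regular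
representation: see `ChatterjeeKumarVolk2024_thm13_holds`. [cite: ChatterjeeKumarVolk2024, Thm. 13] -/
theorem exists_eq_neg_dotProduct_pow_of_isRegularDetRepr {σ : Type v} [Fintype σ]
    (f : MvPolynomial σ F) (d s : ℕ) (hf : f.IsHomogeneous d) (hd : 2 ≤ d)
    (A : Matrix (Fin s) (Fin s) (MvPolynomial σ F)) (hA : IsRegularDetRepr f A) :
    ∃ (b c : Fin (s - 1) → MvPolynomial σ F)
      (D : Matrix (Fin (s - 1)) (Fin (s - 1)) (MvPolynomial σ F)),
      (∀ i, (b i).IsHomogeneous 1) ∧ (∀ i, (c i).IsHomogeneous 1) ∧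
      (∀ i j, (D i j).IsHomogeneous 1) ∧
      f = -(b ⬝ᵥ (D ^ (d - 2)) *ᵥ c) ∧
      ∀ i : ℕ, i + 3 ≤ d → b ⬝ᵥ (D ^ i) *ᵥ c = 0 := by
  classical
  -- `s = 0` is excluded: the determinant of the empty matrix is `1`, not a form of degree `≥ 2`.
  rcases Nat.eq_zero_or_pos s with rfl | hs
  · exfalso
    have h1 : f = 1 := by rw [← hA.1.2, Matrix.det_isEmpty]
    have h0 : d = 0 := hf.inj_right (h1 ▸ isHomogeneous_one σ F) (by rw [h1]; exact one_ne_zero)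
    omega
  obtain ⟨m, rfl⟩ : ∃ m, s = m + 1 := ⟨s - 1, by omega⟩
  show ∃ (b c : Fin m → MvPolynomial σ F) (D : Matrix (Fin m) (Fin m) (MvPolynomial σ F)),
    (∀ i, (b i).IsHomogeneous 1) ∧ (∀ i, (c i).IsHomogeneous 1) ∧
      (∀ i j, (D i j).IsHomogeneous 1) ∧ f = -(b ⬝ᵥ (D ^ (d - 2)) *ᵥ c) ∧
      ∀ i : ℕ, i + 3 ≤ d → b ⬝ᵥ (D ^ i) *ᵥ c = 0
  -- (1) [printed proof, first sentence] elementary row and column operations: the LR normal form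
  -- `(V A U)(0) = Λ_{i₀}` (`IsRegularDetRepr.exists_normalForm`); `det (V A U) = κ f`, `κ ≠ 0`.
  obtain ⟨V, U, i₀, hV, hU, hVAU⟩ := hA.exists_normalForm (Nat.succ_pos m)
  have hκ : V.det * U.det ≠ 0 :=
    mul_ne_zero ((Matrix.isUnit_iff_isUnit_det V).mp hV).ne_zero
      ((Matrix.isUnit_iff_isUnit_det U).mp hU).ne_zero
  set κ : F := V.det * U.det with hκdef
  -- (2) reindex so that `i₀` becomes the `Unit` summand: `M = [[α, bᵀ], [c, 1 - D]]`
  set e : Fin (m + 1) ≃ Unit ⊕ Fin m :=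
    ((finSuccEquiv' i₀).trans (Equiv.optionEquivSumPUnit.{0} (Fin m))).trans (Equiv.sumComm _ _)
    with he
  have he₀ : e i₀ = Sum.inl () := by rw [he]; simp [finSuccEquiv'_at]
  have hsinl : e.symm (Sum.inl ()) = i₀ := by rw [Equiv.symm_apply_eq]; exact he₀.symm
  have hsinr : ∀ j, e.symm (Sum.inr j) ≠ i₀ := fun j h => by
    have h' := congrArg e h
    rw [Equiv.apply_symm_apply, he₀] at h'
    exact Sum.inr_ne_inl h'
  set M : Matrix (Unit ⊕ Fin m) (Unit ⊕ Fin m) (MvPolynomial σ F) :=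
    Matrix.reindex e e (V.map C * A * U.map C) with hM
  have hMdet : M.det = C κ * f := by
    rw [hM, Matrix.det_reindex_self, det_map_C_mul_mul_map_C, hA.1.2]
  have hMdeg : ∀ x y, (M x y).totalDegree ≤ 1 := fun x y =>
    totalDegree_map_C_mul_mul_map_C_le V U hA.1.1 _ _
  have hMcc : ∀ x y, constantCoeff (M x y) = lamMatrix F i₀ (e.symm x) (e.symm y) := fun x y => by
    have h := congrFun (congrFun hVAU (e.symm x)) (e.symm y)
    rw [constPart_apply] at h
    exact h
  -- the linear part `N` of `M`
  set N : Matrix (Unit ⊕ Fin m) (Unit ⊕ Fin m) (MvPolynomial σ F) :=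
    Matrix.of fun x y => homogeneousComponent 1 (M x y) with hN
  have hNhom : ∀ x y, (N x y).IsHomogeneous 1 := fun x y => by
    rw [hN, Matrix.of_apply]; exact homogeneousComponent_isHomogeneous 1 _
  have hMN : ∀ x y, M x y = C (lamMatrix F i₀ (e.symm x) (e.symm y)) + N x y := fun x y => by
    rw [hN, Matrix.of_apply, ← hMcc]
    conv_lhs => rw [eq_homogeneousComponent_zero_add_one (hMdeg x y)]
    rw [homogeneousComponent_zero]
    rfl
  -- the blocks
  set α : MvPolynomial σ F := N (Sum.inl ()) (Sum.inl ()) with hα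
  set b : Fin m → MvPolynomial σ F := fun j => N (Sum.inl ()) (Sum.inr j) with hb
  set c : Fin m → MvPolynomial σ F := fun j => N (Sum.inr j) (Sum.inl ()) with hc
  set D : Matrix (Fin m) (Fin m) (MvPolynomial σ F) :=
    Matrix.of fun j l => -N (Sum.inr j) (Sum.inr l) with hD
  have hDhom : ∀ j l, (D j l).IsHomogeneous 1 := fun j l => by
    rw [hD, Matrix.of_apply]; exact (hNhom _ _).neg
  have hbhom : ∀ j, (b j).IsHomogeneous 1 := fun j => hNhom _ _
  have hchom : ∀ j, (c j).IsHomogeneous 1 := fun j => hNhom _ _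
  have hαhom : α.IsHomogeneous 1 := hNhom _ _
  set Bb : Matrix Unit (Fin m) (MvPolynomial σ F) := Matrix.of fun _ j => b j with hBb
  set Cc : Matrix (Fin m) Unit (MvPolynomial σ F) := Matrix.of fun j _ => c j with hCc
  set Aα : Matrix Unit Unit (MvPolynomial σ F) := Matrix.of fun _ _ => α with hAα
  have hMblocks : M = Matrix.fromBlocks Aα Bb Cc (1 - D) := by
    ext x y
    rw [hMN x y]
    rcases x with ⟨⟩ | j <;> rcases y with ⟨⟩ | l
    · rw [Matrix.fromBlocks_apply₁₁, hAα, Matrix.of_apply, hsinl, lamMatrix_apply, if_pos rfl,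
        if_pos rfl, C_0, zero_add]
    · rw [Matrix.fromBlocks_apply₁₂, hBb, Matrix.of_apply, hsinl, lamMatrix_apply,
        if_neg (hsinr l).symm, C_0, zero_add]
    · rw [Matrix.fromBlocks_apply₂₁, hCc, Matrix.of_apply, hsinl, lamMatrix_apply,
        if_neg (hsinr j), C_0, zero_add]
    · rw [Matrix.fromBlocks_apply₂₂, Matrix.sub_apply, hD, Matrix.of_apply, sub_neg_eq_add,
        Matrix.one_apply, lamMatrix_apply]
      by_cases hjl : j = l
      · subst hjl
        rw [if_pos rfl, if_neg (hsinr j), if_pos rfl, C_1]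
      · have hne : e.symm (Sum.inr j) ≠ e.symm (Sum.inr l) := fun h =>
          hjl (Sum.inr_injective (e.symm.injective h))
        rw [if_neg hne, if_neg hjl, C_0]
  -- (3) [printed proof: Schur complement, `(I - D)^{-1} = Σ Dⁱ` in `F[[x]]`] — here in `F[x]/𝔪_{>d}`,
  -- where `1 - D` is invertible with inverse `S = Σ_{i ≤ d} Dⁱ` because `D^{d+1} ≡ 0`.
  set I : Ideal (MvPolynomial σ F) :=
    { carrier := {p | ∀ k ≤ d, homogeneousComponent k p = 0}
      zero_mem' := fun k _ => map_zero _
      add_mem' := fun {p q} hp hq k hk => by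
        show homogeneousComponent k (p + q) = 0
        rw [map_add, hp k hk, hq k hk, add_zero]
      smul_mem' := fun r {p} hp k hk => by
        show homogeneousComponent k (r • p) = 0
        rw [smul_eq_mul, mul_comm, ← sum_homogeneousComponent r, Finset.mul_sum, map_sum]
        refine Finset.sum_eq_zero fun i _ => ?_
        rw [homogeneousComponent_mul_of_isHomogeneous_right (homogeneousComponent_isHomogeneous i r) p k]
        split_ifs with hik
        · rw [hp (k - i) (by omega), mul_zero]
        · rfl } with hI
  have hmemI : ∀ {p : MvPolynomial σ F}, p ∈ I ↔ ∀ k ≤ d, homogeneousComponent k p = 0 :=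
    fun {p} => Iff.rfl
  have hmemI_of : ∀ {n : ℕ} {p : MvPolynomial σ F}, p.IsHomogeneous n → d < n → p ∈ I :=
    fun {n} {p} hp hn => hmemI.2 fun k hk => by
      rw [homogeneousComponent_of_mem hp, if_neg]
      omega
  set S : Matrix (Fin m) (Fin m) (MvPolynomial σ F) := ∑ i ∈ Finset.range (d + 1), D ^ i with hS
  have hπ0 : ∀ a : MvPolynomial σ F, Ideal.Quotient.mk I a = 0 ↔ a ∈ I := fun a =>
    Ideal.Quotient.eq_zero_iff_mem
  have hDq : ((Ideal.Quotient.mk I).mapMatrix D) ^ (d + 1) = 0 := by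
    rw [← map_pow]
    ext j l
    rw [RingHom.mapMatrix_apply, Matrix.map_apply, Matrix.zero_apply, hπ0]
    exact hmemI_of (isHomogeneous_pow_apply hDhom (d + 1) j l) (by omega)
  have hS1 : (1 - D) * S = 1 - D ^ (d + 1) := mul_neg_geom_sum D (d + 1)
  have hS2 : S * (1 - D) = 1 - D ^ (d + 1) := geom_sum_mul_neg D (d + 1)
  have hS1q : (1 - D).map (Ideal.Quotient.mk I) * S.map (Ideal.Quotient.mk I) = 1 := by
    rw [← Matrix.map_mul, hS1, ← RingHom.mapMatrix_apply, map_sub, map_one, map_pow, hDq, sub_zero]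
  have hS2q : S.map (Ideal.Quotient.mk I) * (1 - D).map (Ideal.Quotient.mk I) = 1 := by
    rw [← Matrix.map_mul, hS2, ← RingHom.mapMatrix_apply, map_sub, map_one, map_pow, hDq, sub_zero]
  haveI hinv : Invertible ((1 - D).map (Ideal.Quotient.mk I)) := ⟨S.map (Ideal.Quotient.mk I), hS2q, hS1q⟩
  have hinvOf : ⅟((1 - D).map (Ideal.Quotient.mk I)) = S.map (Ideal.Quotient.mk I) :=
    invOf_eq_right_inv hS1q
  -- the generators `T i = bᵀ Dⁱ c` and the truncated Schur complement `g = α - Σ_{i ≤ d} T i`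
  set T : ℕ → MvPolynomial σ F := fun i => b ⬝ᵥ (D ^ i) *ᵥ c with hT
  have hThom : ∀ i, (T i).IsHomogeneous (i + 2) := fun i =>
    isHomogeneous_dotProduct_pow_mulVec hbhom hDhom hchom i
  have hBSC : (Bb * S * Cc) () () = ∑ i ∈ Finset.range (d + 1), T i := by
    rw [hS, Matrix.mul_sum, Matrix.sum_mul, Matrix.sum_apply]
    exact Finset.sum_congr rfl fun i _ => row_mul_mul_col_apply b c (D ^ i)
  set g : MvPolynomial σ F := α - ∑ i ∈ Finset.range (d + 1), T i with hg
  have hdetq : Ideal.Quotient.mk I M.det = Ideal.Quotient.mk I ((1 - D).det * g) := by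
    have hdu : ∀ X : Matrix Unit Unit (MvPolynomial σ F ⧸ I), X.det = X () () := fun X =>
      Matrix.det_unique X
    rw [RingHom.map_det, RingHom.mapMatrix_apply, hMblocks, Matrix.fromBlocks_map,
      Matrix.det_fromBlocks₂₂, hdu,
      hinvOf,
      ← Matrix.map_mul, ← Matrix.map_mul, Matrix.sub_apply, Matrix.map_apply, Matrix.map_apply,
      hBSC, hAα, Matrix.of_apply, ← map_sub, ← hg, ← RingHom.mapMatrix_apply, ← RingHom.map_det,
      ← map_mul]
  have hmem : C κ * f - (1 - D).det * g ∈ I := by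
    rw [← Ideal.Quotient.eq, ← hMdet]
    exact hdetq
  -- (4) [printed proof: comparison of homogeneous components] `det (1 - D) = 1 + R`, `R(0) = 0`
  set R : MvPolynomial σ F := (1 - D).det - 1 with hR
  have hR0 : homogeneousComponent 0 R = 0 := homogeneousComponent_zero_det_one_sub hDhom
  have hdetR : (1 - D).det = 1 + R := by rw [hR]; ring
  have key : ∀ k ≤ d,
      ((if k = 1 then α else 0) - ∑ i ∈ Finset.range (d + 1), (if k = i + 2 then T i else 0)) +
        ((if 1 ≤ k then α * homogeneousComponent (k - 1) R else 0) -
          ∑ i ∈ Finset.range (d + 1),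
            (if i + 2 ≤ k then T i * homogeneousComponent (k - (i + 2)) R else 0)) =
        C κ * (if k = d then f else 0) := by
    intro k hk
    have h := (hmemI.1 hmem) k hk
    rw [map_sub, sub_eq_zero, homogeneousComponent_C_mul, homogeneousComponent_of_mem hf, hdetR,
      add_mul, one_mul, map_add] at h
    rw [h]
    congr 1
    · rw [hg, (homogeneousComponent k).map_sub α, map_sum, homogeneousComponent_of_mem hαhom]
      congr 1
      exact (Finset.sum_congr rfl fun i _ => homogeneousComponent_of_mem (hThom i)).symm
    · rw [hg, mul_sub, Finset.mul_sum, (homogeneousComponent k).map_sub (R * α), map_sum,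
        homogeneousComponent_mul_of_isHomogeneous_right hαhom]
      congr 1
      exact (Finset.sum_congr rfl fun i _ =>
        homogeneousComponent_mul_of_isHomogeneous_right (hThom i) R k).symm
  -- degree `1`: `α = 0`
  have hα0 : α = 0 := by
    have h := key 1 (by omega)
    have hz1 : (∑ i ∈ Finset.range (d + 1), (if 1 = i + 2 then T i else 0)) = 0 :=
      Finset.sum_eq_zero fun i _ => if_neg (by omega)
    have hz2 : (∑ i ∈ Finset.range (d + 1),
        (if i + 2 ≤ 1 then T i * homogeneousComponent (1 - (i + 2)) R else 0)) = 0 :=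
      Finset.sum_eq_zero fun i _ => if_neg (by omega)
    rw [if_pos rfl, if_pos le_rfl, Nat.sub_self, hR0, mul_zero, hz1, hz2, sub_zero, sub_zero,
      add_zero, if_neg (show ¬ (1 = d) by omega), mul_zero] at h
    exact h
  -- degree `i + 2`: `-T i = κ f` if `i + 2 = d`, and `0` below, given the lower `T i'` vanish
  have step : ∀ i, i + 2 ≤ d → (∀ i', i' < i → T i' = 0) →
      -T i = C κ * (if i + 2 = d then f else 0) := by
    intro i hi hprev
    have h := key (i + 2) hi
    have hsum1 : (∑ i' ∈ Finset.range (d + 1), (if i + 2 = i' + 2 then T i' else 0)) = T i := by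
      rw [Finset.sum_eq_single i, if_pos rfl]
      · intro i' _ hne; exact if_neg (by omega)
      · intro hi'; exact absurd (Finset.mem_range.2 (by omega)) hi'
    have hsum2 : (∑ i' ∈ Finset.range (d + 1),
        (if i' + 2 ≤ i + 2 then T i' * homogeneousComponent (i + 2 - (i' + 2)) R else 0)) = 0 := by
      refine Finset.sum_eq_zero fun i' _ => ?_
      split_ifs with hle
      · rcases Nat.lt_or_ge i' i with hlt | hge
        · rw [hprev i' hlt, zero_mul]
        · obtain rfl : i' = i := by omega
          rw [Nat.sub_self, hR0, mul_zero]
      · rfl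
    rw [if_neg (show ¬ (i + 2 = 1) by omega), zero_sub, hsum1, if_pos (show 1 ≤ i + 2 by omega),
      hα0, zero_mul, zero_sub, hsum2, neg_zero, add_zero] at h
    exact h
  have hvan : ∀ i, i + 3 ≤ d → T i = 0 := by
    intro i
    induction i using Nat.strong_induction_on with
    | _ i ih =>
      intro hi
      have h := step i (by omega) fun i' hi' => ih i' hi' (by omega)
      rwa [if_neg (show ¬ (i + 2 = d) by omega), mul_zero, neg_eq_zero] at h
  have hfin : -T (d - 2) = C κ * f := by
    have h := step (d - 2) (by omega) fun i' hi' => hvan i' (by omega)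
    rwa [if_pos (show d - 2 + 2 = d by omega)] at h
  -- (5) the witnesses: absorb `κ⁻¹` into `b`
  have hT' : ∀ i, (fun j => C κ⁻¹ * b j) ⬝ᵥ (D ^ i) *ᵥ c = C κ⁻¹ * T i := fun i => by
    simp only [hT, dotProduct, Finset.mul_sum, mul_assoc]
  refine ⟨fun j => C κ⁻¹ * b j, c, D, fun j => (hbhom j).C_mul _, hchom, hDhom, ?_,
    fun i hi => by rw [hT', hvan i hi, mul_zero]⟩
  have hf' : C κ⁻¹ * (C κ * f) = f := by
    rw [← mul_assoc, ← C_mul, inv_mul_cancel₀ hκ, C_1, one_mul]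
  rw [hT', ← hf', ← hfin, mul_neg]

end CKV2024

/-- **DISCHARGE of `ChatterjeeKumarVolk2024_thm13`** (Chatterjee–Kumar–Volk 2024, Thm. 13 with the
remark following its proof): a regular affine determinantal representation of size `s` of a form
`f` of degree `d ≥ 2` yields `f = -bᵀ D^{d-2} c` with linear `b, c, D` of width `s - 1` and
`bᵀ Dⁱ c = 0` for `i ≤ d - 3`.
[cite: ChatterjeeKumarVolk2024, Thm. 13 + remark after its proof (arXiv:2308.04599 §3)] -/
theorem ChatterjeeKumarVolk2024_thm13_holds :
    ∀ (F : Type u) [Field F], ChatterjeeKumarVolk2024_thm13.{u, v} (F := F) :=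
  fun _ _ _ _ f d s hf hd A hA => CKV2024.exists_eq_neg_dotProduct_pow_of_isRegularDetRepr f d s hf hd A hA

end Literature.Computability.AlgebraicComplexity
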